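import Mathlib
import Summits.MatrixMultiplication.MatrixMultiplication.Theorems.SnSubsetDichotomyPolynomialSlackDeficitBudget
import Summits.MatrixMultiplication.MatrixMultiplication.Theorems.SnSubsetDichotomyPolynomialSlackPermBernstein

/-!
# The two-sided level-one inequality for SPREAD sets of permutations

Crux `Summit.MatrixMultiplication.MatrixMultiplication.Theses.SnSubsetDichotomy.PolynomialSlack`
(item `stmt-MatrixMultiplication-8306`), level-one programme, lead c3. For `X ⊆ S_n` with marginals
`M_X(i,j) = #{x ∈ X : x j = i}` the Parseval bound ("excess cap") is `(n-1)·Σ(M - |X|/n)² ≤ |X|·(n! - |X|)`,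
i.e. `(n-1)‖Δ_X‖² ≤ K - 1` with `K = n!/|X|`; it is attained by point cylinders `{x j₀ = i₀}`. If `X` is
`λ`-SPREAD at level one, `M_X(i,j) ≤ λ|X|/n` for all `i, j` (no point cell carries more than `λ` times its
share), the level-one energy is only logarithmic in `K`:

  `Σ_{i,j} (M_X(i,j) - |X|/n)² ≤ 100·(1 + log n)·λ·(|X|²/n)·log(4n·n!/|X|)`      (`spread_level_one`),

the permutation analogue of the level-one inequality for global functions (Keevash–Lifshitz–Minzer /
Filmus–Kindler–Lifshitz–Minzer hypercontractivity), here with crude constants and an extra `1 + log n`, but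
SELF-CONTAINED: the proof is the tree's Bernstein inequality for permuted sums `card_permutedSum_tail_le`
applied to the level-one statistic `F(π) = Σ_j η(π j, j)`, `η = (M - |X|/n)·n/(λ|X|) ∈ [-1, 1]`, whose mean
over `S_n` is `0` (column sums of `M` are `|X|`) and whose mean over `X` is EXACTLY `λ·v`,
`v = Ση²/n` (KEY IDENTITY `Σ_{x∈X} F(x) = Σ η·M = λ|X|v`); one threshold `t₀ = √(64(1+log n)vL) + 16L`,
`L = log(4n·n!/|X|)`, tail mass `≤ |X|/n` and `F ≤ n` give `λv ≤ t₀ + 1 ≤ 100(1+log n)L`.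
Use (lead c3 crux notes §E.4): with the Bernstein saving on one pair quotient, a crux violator must have two
pair quotients that are NOT `√n/polylog`-spread, i.e. members with point concentrations.
-/

namespace Summit.MatrixMultiplication.MatrixMultiplication.Theorems.PolynomialSlack

open scoped BigOperators

set_option linter.dupNamespace false

/-- Column sums of the marginal counts: `Σ_i #{x ∈ X : x j = i} = |X|` (fibres of `x ↦ x j`). [folklore] -/
theorem sum_marginal_col {n : ℕ} (X : Finset (Equiv.Perm (Fin n))) (j : Fin n) :
    ∑ i : Fin n, ((X.filter fun x => x j = i).card : ℝ) = X.card := by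
  have h := Finset.card_eq_sum_card_fiberwise (f := fun x : Equiv.Perm (Fin n) => x j) (s := X)
    (t := Finset.univ) (fun x _ => Finset.mem_univ _)
  rw [h]; push_cast; rfl

set_option maxHeartbeats 800000 in
/-- **Two-sided level-one inequality for spread sets.** For `X ⊆ S_n` non-empty and `λ ≥ 1` with
`#{x ∈ X : x j = i} ≤ λ|X|/n` for all `i, j`,
`Σ_{i,j} (#{x ∈ X : x j = i} - |X|/n)² ≤ 100·(1 + log n)·λ·(|X|²/n)·log(4n·n!/|X|)`.
Proof: Bernstein for permuted sums (`card_permutedSum_tail_le`) on `F(π) = Σ_j η(π j, j)`,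
`η = (M - |X|/n)·n/(λ|X|) ∈ [-1,1]`, mean `0` over `S_n`, mean `λv` over `X` (`v = Ση²/n`), `F ≤ n`,
threshold `t₀ = √(64(1+log n)vL) + 16L`; then `λv ≤ t₀ + 1` and AM–GM. [folklore] -/
theorem spread_level_one {n : ℕ} (hn : 1 ≤ n) (X : Finset (Equiv.Perm (Fin n))) (hX : X.Nonempty)
    (lam : ℝ) (hlam : 1 ≤ lam)
    (hspread : ∀ i j : Fin n, ((X.filter fun x => x j = i).card : ℝ) ≤ lam * X.card / n) :
    ∑ i : Fin n, ∑ j : Fin n, (((X.filter fun x => x j = i).card : ℝ) - (X.card : ℝ) / n) ^ 2 ≤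
      100 * (1 + Real.log n) * lam * ((X.card : ℝ) ^ 2 / n) * Real.log (4 * n * n.factorial / X.card) := by
  classical
  -- notation
  set α : ℝ := (X.card : ℝ) with hα
  have hα0 : 0 < α := by rw [hα]; exact_mod_cast hX.card_pos
  have hnR : (1 : ℝ) ≤ n := by exact_mod_cast hn
  have hn0 : (0 : ℝ) < n := by linarith
  have hlam0 : 0 < lam := by linarith
  set M : Fin n → Fin n → ℝ := fun i j => ((X.filter fun x => x j = i).card : ℝ) with hM
  set η : Fin n → Fin n → ℝ := fun i j => (M i j - α / n) * (n / (lam * α)) with hη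
  have hM0 : ∀ i j, 0 ≤ M i j := fun i j => Nat.cast_nonneg _
  have hMle : ∀ i j, M i j ≤ lam * α / n := fun i j => hspread i j
  have hη1 : ∀ i j, η i j ≤ 1 := fun i j => by
    have h1 : M i j - α / n ≤ lam * α / n := by linarith [hMle i j, div_nonneg hα0.le hn0.le]
    calc η i j = (M i j - α / n) * (n / (lam * α)) := rfl
      _ ≤ (lam * α / n) * (n / (lam * α)) := mul_le_mul_of_nonneg_right h1 (by positivity)
      _ = 1 := by field_simp
  have hηm1 : ∀ i j, -1 ≤ η i j := fun i j => by
    have h1 : -(α / n) ≤ M i j - α / n := by linarith [hM0 i j]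
    have h2 : -(α / n) * (n / (lam * α)) ≤ η i j := mul_le_mul_of_nonneg_right h1 (by positivity)
    have h3 : -(α / n) * (n / (lam * α)) = -(1 / lam) := by field_simp
    rw [h3] at h2
    have h4 : 1 / lam ≤ 1 := by rw [div_le_one hlam0]; exact hlam
    linarith
  have hMη : ∀ i j, M i j = α / n + (lam * α / n) * η i j := fun i j => by
    simp only [hη]; field_simp; ring
  -- column sums: `Σ_i η i j = 0`
  have hcol : ∀ j, ∑ i : Fin n, η i j = 0 := by
    intro j
    have h1 : ∑ i : Fin n, M i j = α := by rw [hα]; exact sum_marginal_col X j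
    calc ∑ i : Fin n, η i j = (∑ i : Fin n, (M i j - α / n)) * (n / (lam * α)) := by
          rw [Finset.sum_mul]
      _ = 0 := by
          rw [Finset.sum_sub_distrib, h1, Finset.sum_const, Finset.card_univ, Fintype.card_fin,
            nsmul_eq_mul]
          field_simp; ring
  have hmean : (∑ j : Fin n, ∑ i : Fin n, η i j) / n = 0 := by
    rw [Finset.sum_eq_zero (fun j _ => hcol j), zero_div]
  -- the variance proxy
  set v : ℝ := (∑ j : Fin n, ∑ i : Fin n, η i j ^ 2) / n with hv
  have hv0 : 0 ≤ v := div_nonneg (Finset.sum_nonneg fun _ _ => Finset.sum_nonneg fun _ _ => sq_nonneg _) hn0.le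
  -- KEY IDENTITY: `Σ_{x ∈ X} F(x) = λ α v`
  have hkey : ∑ x ∈ X, ∑ j : Fin n, η (x j) j = lam * α * v := by
    rw [sum_sum_apply_eq_sum_mul_marginal X η]
    simp_rw [show ∀ i j, η i j * ((X.filter fun x => x j = i).card : ℝ) = η i j * M i j from
      fun i j => rfl, hMη]
    have : ∀ i j, η i j * (α / n + lam * α / n * η i j) = α / n * η i j + lam * α / n * η i j ^ 2 := by
      intro i j; ring
    simp_rw [this, Finset.sum_add_distrib, ← Finset.mul_sum]
    rw [Finset.sum_comm (s := Finset.univ) (t := Finset.univ) (f := fun i j => η i j),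
      Finset.sum_eq_zero (fun j _ => hcol j), mul_zero, zero_add, hv,
      Finset.sum_comm (s := Finset.univ) (t := Finset.univ) (f := fun j i => η i j ^ 2)]
    field_simp
  -- `F ≤ n` pointwise
  have hFle : ∀ x : Equiv.Perm (Fin n), ∑ j : Fin n, η (x j) j ≤ n := fun x => by
    calc ∑ j : Fin n, η (x j) j ≤ ∑ _j : Fin n, (1 : ℝ) := Finset.sum_le_sum fun j _ => hη1 _ _
      _ = n := by simp
  -- the threshold
  set L : ℝ := Real.log (4 * n * n.factorial / X.card) with hL
  set G : ℝ := 1 + Real.log n with hG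
  have hG1 : 1 ≤ G := by rw [hG]; linarith [Real.log_nonneg hnR]
  have hY : 4 ≤ 4 * n * n.factorial / α := by
    rw [le_div_iff₀ hα0]
    have hf : (1 : ℝ) ≤ n.factorial := by exact_mod_cast n.factorial_pos
    have hαle : α ≤ n.factorial := by
      rw [hα]
      have : X.card ≤ Fintype.card (Equiv.Perm (Fin n)) := Finset.card_le_univ _
      rw [Fintype.card_perm, Fintype.card_fin] at this
      exact_mod_cast this
    nlinarith
  have hY0 : 0 < 4 * n * n.factorial / α := by linarith
  have hL1 : 1 ≤ L := by
    rw [hL, ← hα, Real.le_log_iff_exp_le hY0]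
    exact le_trans Real.exp_one_lt_d9.le (by linarith)
  have hL0 : 0 < L := by linarith
  set r : ℝ := Real.sqrt (64 * G * v * L) with hr
  have hr0 : 0 ≤ r := Real.sqrt_nonneg _
  have h64 : 0 ≤ 64 * G * v * L := by
    have : 0 ≤ G * v := mul_nonneg (by linarith) hv0
    nlinarith [hL0.le]
  have hrsq : r * r = 64 * G * v * L := Real.mul_self_sqrt h64
  set t₀ : ℝ := r + 16 * L with ht₀
  have ht₀0 : 0 < t₀ := by rw [ht₀]; linarith
  have hproxy : 32 * (1 + Real.log n) * (∑ j : Fin n, ∑ i : Fin n, η i j ^ 2) / n = 32 * G * v := by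
    rw [hv, hG]; ring
  have hden0 : 0 < 32 * G * v + 8 * 1 * t₀ := by
    have : 0 ≤ G * v := mul_nonneg (by linarith) hv0
    linarith
  have hexp : L ≤ t₀ ^ 2 / (32 * G * v + 8 * 1 * t₀) := by
    rw [le_div_iff₀ hden0, ht₀]
    nlinarith [hrsq, hr0, hL0.le, mul_nonneg hr0 hL0.le, mul_nonneg (by linarith : (0 : ℝ) ≤ G) hv0]
  -- Bernstein for `a j i := η i j ∈ [-1, 1]`
  have hBound := card_permutedSum_tail_le (n := n) 1 (fun j i => η i j) (fun j i => by
    rw [abs_le]; exact ⟨hηm1 i j, hη1 i j⟩) t₀ ht₀0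
  rw [hproxy, hmean] at hBound
  have htail : 2 * (n.factorial : ℝ) *
      Real.exp (-(t₀ ^ 2 / (32 * G * v + 8 * 1 * t₀))) ≤ α / n := by
    have h1 : Real.exp (-(t₀ ^ 2 / (32 * G * v + 8 * 1 * t₀))) ≤ Real.exp (-L) :=
      Real.exp_le_exp.2 (neg_le_neg hexp)
    have h2 : Real.exp (-L) = α / (4 * n * n.factorial) := by
      rw [Real.exp_neg, hL, ← hα, Real.exp_log hY0, inv_div]
    have hf0 : (0 : ℝ) < n.factorial := by exact_mod_cast n.factorial_pos
    calc 2 * (n.factorial : ℝ) * Real.exp (-(t₀ ^ 2 / (32 * G * v + 8 * 1 * t₀)))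
        ≤ 2 * (n.factorial : ℝ) * Real.exp (-L) := by gcongr
      _ = α / n / 2 := by rw [h2]; field_simp; ring
      _ ≤ α / n := by linarith [div_nonneg hα0.le hn0.le]
  -- split `X` at the threshold (upper tail)
  set B := X.filter fun x => t₀ ≤ ∑ j : Fin n, η (x j) j with hB
  have hBsub : B.card ≤ (Finset.univ.filter fun π : Equiv.Perm (Fin n) =>
      t₀ ≤ |∑ j : Fin n, η (π j) j - 0|).card := by
    refine Finset.card_le_card fun x hx => ?_
    rw [Finset.mem_filter] at hx ⊢
    refine ⟨Finset.mem_univ _, ?_⟩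
    rw [sub_zero]
    exact hx.2.trans (le_abs_self _)
  have hBcard : (B.card : ℝ) ≤ α / n := by
    calc (B.card : ℝ) ≤ ((Finset.univ.filter fun π : Equiv.Perm (Fin n) =>
          t₀ ≤ |∑ j : Fin n, η (π j) j - 0|).card : ℝ) := by exact_mod_cast hBsub
      _ ≤ _ := hBound
      _ ≤ α / n := htail
  -- `λ α v = Σ_{x ∈ X} F x ≤ n · |B| + α t₀`
  have hsplit : lam * α * v ≤ n * B.card + α * t₀ := by
    rw [← hkey, ← Finset.sum_filter_add_sum_filter_not X (fun x => t₀ ≤ ∑ j : Fin n, η (x j) j)]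
    have h1 : ∑ x ∈ X.filter (fun x => t₀ ≤ ∑ j : Fin n, η (x j) j), ∑ j : Fin n, η (x j) j ≤
        n * B.card := by
      rw [← hB]
      calc ∑ x ∈ B, ∑ j : Fin n, η (x j) j ≤ ∑ _x ∈ B, (n : ℝ) := Finset.sum_le_sum fun x _ => hFle x
        _ = n * B.card := by rw [Finset.sum_const, nsmul_eq_mul, mul_comm]
    have h2 : ∑ x ∈ X.filter (fun x => ¬ (t₀ ≤ ∑ j : Fin n, η (x j) j)), ∑ j : Fin n, η (x j) j ≤
        α * t₀ := by
      calc ∑ x ∈ X.filter (fun x => ¬ (t₀ ≤ ∑ j : Fin n, η (x j) j)), ∑ j : Fin n, η (x j) j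
          ≤ ∑ _x ∈ X.filter (fun x => ¬ (t₀ ≤ ∑ j : Fin n, η (x j) j)), t₀ :=
            Finset.sum_le_sum fun x hx => (not_le.1 (Finset.mem_filter.1 hx).2).le
        _ = t₀ * (X.filter (fun x => ¬ (t₀ ≤ ∑ j : Fin n, η (x j) j))).card := by
            rw [Finset.sum_const, nsmul_eq_mul, mul_comm]
        _ ≤ t₀ * α := by
            rw [hα]
            exact mul_le_mul_of_nonneg_left (by exact_mod_cast Finset.card_filter_le _ _) ht₀0.le
        _ = α * t₀ := mul_comm _ _
    linarith
  -- hence `λ v ≤ t₀ + 1`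
  have hv1 : lam * v ≤ t₀ + 1 := by
    have h1 : (n : ℝ) * B.card ≤ n * (α / n) := mul_le_mul_of_nonneg_left hBcard hn0.le
    have h2 : (n : ℝ) * (α / n) = α := by field_simp
    rw [h2] at h1
    have h3 : α * (lam * v) ≤ α * (t₀ + 1) := by nlinarith
    exact le_of_mul_le_mul_left h3 hα0
  -- AM-GM: with `u = λ v ≥ v`, `r = √(64 G v L) ≤ √(64 G u L) ≤ u/2 + 32 G L`
  have huL : lam * v ≤ 100 * G * L := by
    set u : ℝ := lam * v with hu
    have hvu : v ≤ u := by
      rw [hu]; nlinarith [hv0, hlam]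
    have hu0 : 0 ≤ u := le_trans hv0 hvu
    have hamgm : r ≤ u / 2 + 32 * G * L := by
      have hS0 : 0 ≤ u / 2 + 32 * G * L := by
        have := mul_nonneg (by linarith : (0 : ℝ) ≤ G) hL0.le; linarith
      have hGL : 0 ≤ G * L := mul_nonneg (by linarith) hL0.le
      have hsq : r ^ 2 ≤ (u / 2 + 32 * G * L) ^ 2 := by
        have e1 : r ^ 2 = 64 * G * v * L := by rw [sq]; exact hrsq
        have e2 : 64 * G * v * L ≤ 64 * G * u * L := by nlinarith [hvu, hGL]
        nlinarith [sq_nonneg (u / 2 - 32 * G * L), e1, e2]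
      exact (pow_le_pow_iff_left₀ hr0 hS0 two_ne_zero).1 hsq
    have : u ≤ (64 * G + 32) * L + 2 := by rw [ht₀] at hv1; linarith
    nlinarith [hG1, hL1, this]
  -- back to `M`: `Σ (M - α/n)² = (λα/n)² · n · v = (λ α²/n) · (λ v)`
  have hsum : ∑ i : Fin n, ∑ j : Fin n, (M i j - α / n) ^ 2 = (lam * α ^ 2 / n) * (lam * v) := by
    have hcell : ∀ i j, (M i j - α / n) ^ 2 = (lam * α / n) ^ 2 * η i j ^ 2 := fun i j => by
      rw [hMη i j]; ring
    calc ∑ i : Fin n, ∑ j : Fin n, (M i j - α / n) ^ 2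
        = ∑ i : Fin n, ∑ j : Fin n, (lam * α / n) ^ 2 * η i j ^ 2 :=
          Finset.sum_congr rfl fun i _ => Finset.sum_congr rfl fun j _ => hcell i j
      _ = (lam * α / n) ^ 2 * ∑ i : Fin n, ∑ j : Fin n, η i j ^ 2 := by
          rw [Finset.mul_sum]
          refine Finset.sum_congr rfl fun i _ => ?_
          rw [Finset.mul_sum]
      _ = (lam * α ^ 2 / n) * (lam * v) := by
          rw [hv, Finset.sum_comm (s := Finset.univ) (t := Finset.univ) (f := fun j i => η i j ^ 2)]
          field_simp
  calc ∑ i : Fin n, ∑ j : Fin n, (((X.filter fun x => x j = i).card : ℝ) - (X.card : ℝ) / n) ^ 2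
      = ∑ i : Fin n, ∑ j : Fin n, (M i j - α / n) ^ 2 := rfl
    _ = (lam * α ^ 2 / n) * (lam * v) := hsum
    _ ≤ (lam * α ^ 2 / n) * (100 * G * L) :=
        mul_le_mul_of_nonneg_left huL (div_nonneg (mul_nonneg hlam0.le (sq_nonneg α)) hn0.le)
    _ = 100 * (1 + Real.log n) * lam * ((X.card : ℝ) ^ 2 / n) *
          Real.log (4 * n * n.factorial / X.card) := by
        rw [hL, hG, ← hα]; ring

end Summit.MatrixMultiplication.MatrixMultiplication.Theorems.PolynomialSlack
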